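import Mathlib
import Literature.LinearAlgebra.Matrix.RankMinors
import Literature.RingTheory.Valuation.RootReduction
import Summits.ValiantsHypothesis.ValiantsHypothesis.Theorems.FeketeSOSSublinearShadowMaxMinorFactor

/-!
# `FeketeSOS.SublinearShadow` (stmt-ValiantsHypothesis-14990), line `Sketch`, reshape 6 — stubs
# `stub_maxMinorFactorField` and `stub_qfModelField`

Field-general port of the maximal-minor factorisation and of the integral quadratic-form (Gram) model
over a valuation subring: the landed `ℂ`-versions are `stub_maxMinorFactor` (with `mmf_exists_max_minor`,
`mmf_core`) in `FeketeSOSSublinearShadowMaxMinorFactor` (p138363) and `gsh_coeff_colPoly`, `gsh_qf_model`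
in `FeketeSOSSublinearShadowGramShadow` (p139058).  Here `ℂ` is replaced by an arbitrary field `F` and
`O` is a valuation subring of `F`; the proofs only use `O.valuation` and generic `Valuation` lemmas.

**Maximal-minor factorisation.**  Let `O ⊂ F` be a valuation subring and `V ∈ F^{m × s}`.  Then
`V = H · V[a, ·]` for some `r ≤ s`, some rows `a : Fin r → m` of `V`, and an `O`-integral matrix
`H ∈ O^{m × r}` normalised by `H[a_{j'}, j] = δ_{jj'}`: choose a column basis `I : Fin r → Fin s`
(`mmf_colBasis`), put `W = V[·, I]`, choose rows `a` maximising the valuation of the minor `det W[a, ·]`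
(nonzero since `W` has rank `r`), and set `H = W · W[a, ·]⁻¹`, which is `O`-integral by Cramer's rule.

**Integral quadratic-form model.**  For `c : Fin s → F`, `g : Fin s → F[X]` apply the factorisation to
the coefficient matrix `V_{b,i} = g_{i,b}` (`b ∈ U = ∪ supp g_i`): `g_i = Σ_{j<r} g_{i,a_j} h_j` with
`h_j ∈ O[X]` (the columns of `H` read as polynomials on `U`), `h_{j, a_{j'}} = δ_{jj'}`, and then
`Σ c_i g_i² = Σ_{j,j'} Q_{a_j a_{j'}} h_j h_{j'}` with the Gram entries `Q_{ab} = Σ_i c_i g_{i,a} g_{i,b}`.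
-/

namespace Summit.ValiantsHypothesis.ValiantsHypothesis.Theorems.SublinearShadowSketch

-- `Summit.ValiantsHypothesis.ValiantsHypothesis.…` is the tree's mandated single-conjunct layout (Sub = Summit).
set_option linter.dupNamespace false

open Polynomial Finset IsLocalRing Matrix
open scoped BigOperators

/-- **The maximal minor (field-general).** If `W ∈ F^{m × r}` has linearly independent columns then some
row selection `a : Fin r → m` maximises, over all row selections, the valuation at `O` of the minor
`det W[a, ·]`, and this maximal minor is nonzero. [folklore] -/
theorem qmf_exists_max_minor {F : Type*} [Field F] (O : ValuationSubring F) {m : Type*} [Fintype m]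
    {r : ℕ} (W : Matrix m (Fin r) F) (hW : LinearIndependent F W.col) :
    ∃ a : Fin r → m, (W.submatrix a _root_.id).det ≠ 0 ∧
      ∀ a' : Fin r → m,
        O.valuation (W.submatrix a' _root_.id).det ≤ O.valuation (W.submatrix a _root_.id).det := by
  classical
  obtain ⟨a₀, ha₀⟩ := mmf_exists_det_ne_zero W hW
  obtain ⟨a, -, hmax⟩ := Finset.exists_max_image Finset.univ
    (fun a : Fin r → m => O.valuation (W.submatrix a _root_.id).det) ⟨a₀, Finset.mem_univ _⟩
  refine ⟨a, fun h0 => ?_, fun a' => hmax a' (Finset.mem_univ _)⟩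
  have h1 := lt_of_lt_of_le ((Valuation.pos_iff _).2 ha₀) (hmax a₀ (Finset.mem_univ _))
  rw [h0, _root_.map_zero] at h1
  exact lt_irrefl _ h1

/-- **Maximal-minor factorisation of a matrix with independent columns (field-general).** If
`W ∈ F^{m × r}` has linearly independent columns then, for a row selection `a` whose minor `M = W[a, ·]`
has maximal valuation at `O`, the matrix `H = W · M⁻¹` is `O`-integral (Cramer's rule), `H[a, ·] = 1`,
and `W = H · W[a, ·]`. [folklore] -/
theorem qmf_core {F : Type*} [Field F] (O : ValuationSubring F) {m : Type*} [Fintype m] {r : ℕ}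
    (W : Matrix m (Fin r) F) (hW : LinearIndependent F W.col) :
    ∃ (a : Fin r → m) (H : Matrix m (Fin r) F), (∀ b j, H b j ∈ O) ∧
      (∀ j j', H (a j') j = if j = j' then 1 else 0) ∧ W = H * W.submatrix a _root_.id := by
  classical
  obtain ⟨a, hdet, hmax⟩ := qmf_exists_max_minor O W hW
  have hMu : IsUnit (W.submatrix a _root_.id).det := isUnit_iff_ne_zero.2 hdet
  refine ⟨a, W * (W.submatrix a _root_.id)⁻¹, fun b j => ?_, fun j j' => ?_, ?_⟩
  · -- integrality: Cramer's rule and the maximality of the minor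
    have e : (W * (W.submatrix a _root_.id)⁻¹) b j =
        ((W.submatrix a _root_.id).det)⁻¹ * (W.submatrix (Function.update a j b) _root_.id).det := by
      rw [← mmf_updateRow_submatrix]
      exact mmf_vecMul_inv_apply _ (W b) j
    rw [e, ← O.valuation_le_one_iff, _root_.map_mul, _root_.map_inv₀]
    have hv : O.valuation (W.submatrix a _root_.id).det ≠ 0 := (Valuation.ne_zero_iff _).2 hdet
    calc (O.valuation (W.submatrix a _root_.id).det)⁻¹ *
          O.valuation (W.submatrix (Function.update a j b) _root_.id).det
        ≤ (O.valuation (W.submatrix a _root_.id).det)⁻¹ * O.valuation (W.submatrix a _root_.id).det :=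
          mul_le_mul_right (hmax _) _
      _ = 1 := inv_mul_cancel₀ hv
  · -- normalisation: `H[a, ·] = M · M⁻¹ = 1`
    change (W.submatrix a _root_.id * (W.submatrix a _root_.id)⁻¹) j' j = _
    rw [Matrix.mul_nonsing_inv _ hMu]
    by_cases h : j = j'
    · subst h; simp
    · rw [Matrix.one_apply_ne (Ne.symm h), if_neg h]
  · rw [Matrix.mul_assoc, Matrix.nonsing_inv_mul _ hMu, Matrix.mul_one]

/-- **Stub (W1): maximal-minor factorisation over a valuation subring of an arbitrary field.**  For a valuation subring
`O` of a field `F` and `V ∈ F^{m × s}`: `V = H · V[a, ·]` for some `r ≤ s` rows `a : Fin r → m`, with `H ∈ O^{m × r}` and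
`H[a_{j'}, j] = δ_{jj'}` (column basis, then the `r × r` minor of maximal valuation; Cramer's rule).  [folklore] -/
theorem stub_maxMinorFactorField {F : Type} [Field F] (O : ValuationSubring F) {m : Type} [Fintype m] [DecidableEq m]
    (s : ℕ) (V : Matrix m (Fin s) F) :
    ∃ (r : ℕ) (a : Fin r → m) (H : Matrix m (Fin r) F),
      r ≤ s ∧ (∀ b j, H b j ∈ O) ∧ (∀ j j', H (a j') j = if j = j' then 1 else 0) ∧
      V = H * V.submatrix a _root_.id := by
  obtain ⟨r, I, hrs, hli, hspan⟩ := mmf_colBasis V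
  obtain ⟨a, H, hint, hone, hfac⟩ := qmf_core O (V.submatrix _root_.id I) hli
  refine ⟨r, a, H, hrs, hint, hone, ?_⟩
  -- every column of `V` is a combination of the basis columns: `V = V[·, I] · Q`
  have hcol : ∀ i, V.col i ∈ Submodule.span F (Set.range (V.submatrix _root_.id I).col) := fun i => by
    rw [hspan]; exact Submodule.subset_span (Set.mem_range_self i)
  choose P hP using fun i => (Submodule.mem_span_range_iff_exists_fun F).1 (hcol i)
  have hVQ : V = V.submatrix _root_.id I * Matrix.of (fun j i => P i j) := by
    ext b i
    have h := congrFun (hP i) b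
    simp only [Finset.sum_apply, Pi.smul_apply, smul_eq_mul, Matrix.col_apply] at h
    rw [Matrix.mul_apply, ← h]
    exact Finset.sum_congr rfl fun j _ => by rw [Matrix.of_apply, mul_comm]
  calc V = V.submatrix _root_.id I * Matrix.of (fun j i => P i j) := hVQ
    _ = H * (V.submatrix _root_.id I).submatrix a _root_.id * Matrix.of (fun j i => P i j) := by
        rw [← hfac]
    _ = H * (V.submatrix _root_.id I * Matrix.of (fun j i => P i j)).submatrix a _root_.id := by
        rw [Matrix.submatrix_mul _ _ a _root_.id _root_.id Function.bijective_id, Matrix.submatrix_id_id,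
          Matrix.mul_assoc]
    _ = H * V.submatrix a _root_.id := by rw [← hVQ]

/-- The polynomial with coefficient vector a column of a matrix (over a semiring `F`) indexed by a finite
set `U` of exponents: its coefficients are the matrix entries on `U` and `0` off `U`. -/
theorem qmf_coeff_colPoly {F : Type*} [Semiring F] {U : Finset ℕ} {r : ℕ} (H : Matrix U (Fin r) F)
    (j : Fin r) (n : ℕ) :
    (∑ b : U, C (H b j) * X ^ (b : ℕ)).coeff n = if hn : n ∈ U then H ⟨n, hn⟩ j else 0 := by
  classical
  rw [finsetSum_coeff]
  simp only [coeff_C_mul_X_pow]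
  by_cases hn : n ∈ U
  · rw [dif_pos hn, Finset.sum_eq_single ⟨n, hn⟩]
    · simp
    · intro b _ hb
      rw [if_neg]
      intro h
      exact hb (Subtype.ext h.symm)
    · intro h; exact absurd (Finset.mem_univ _) h
  · rw [dif_neg hn]
    refine Finset.sum_eq_zero fun b _ => ?_
    rw [if_neg]
    intro h
    exact hn (h ▸ b.2)

/-- **Stub (W2): integral quadratic-form (Gram) model over a valuation subring of an arbitrary field.**  For any
`c : Fin s → F`, `g : Fin s → F[X]`: there are `r ≤ s` polynomials `h_j ∈ O[X]` supported on `U = ∪ supp g_i` and exponents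
`a_j` with `h_{j, a_{j'}} = δ_{jj'}`, `g_i = Σ_j g_{i,a_j} h_j`, and `Σ c_i g_i² = Σ_{j,j'} Q_{a_j a_{j'}} h_j h_{j'}` with the Gram
entries `Q_{ab} = Σ_i c_i g_{i,a} g_{i,b}` as coefficients.  [folklore] -/
theorem stub_qfModelField {F : Type} [Field F] (O : ValuationSubring F) (s : ℕ) (c : Fin s → F) (g : Fin s → F[X]) :
    ∃ (r : ℕ) (a : Fin r → ℕ) (h : Fin r → F[X]), r ≤ s ∧
      (∀ j n, (h j).coeff n ∈ O) ∧
      (∀ j, (h j).support ⊆ Finset.univ.biUnion fun i => (g i).support) ∧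
      (∀ j j', (h j).coeff (a j') = if j = j' then 1 else 0) ∧
      (∀ i, g i = ∑ j, C ((g i).coeff (a j)) * h j) ∧
      (∑ i, C (c i) * g i ^ 2)
        = ∑ j, ∑ j', C (∑ i, c i * (g i).coeff (a j) * (g i).coeff (a j')) * (h j * h j') := by
  classical
  -- the union of the supports and the coefficient matrix
  set U : Finset ℕ := Finset.univ.biUnion fun i => (g i).support with hU
  have hsuppU : ∀ i, (g i).support ⊆ U := fun i =>
    Finset.subset_biUnion_of_mem (fun i => (g i).support) (Finset.mem_univ i)
  set V : Matrix U (Fin s) F := fun b i => (g i).coeff b with hV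
  -- (1) maximal-minor factorisation
  obtain ⟨r, a, H, hr, hHint, hHδ, hVH⟩ := stub_maxMinorFactorField O s V
  set h : Fin r → F[X] := fun j => ∑ b : U, C (H b j) * X ^ (b : ℕ) with hh
  have hcoef_h : ∀ j n, (h j).coeff n = if hn : n ∈ U then H ⟨n, hn⟩ j else 0 := fun j n =>
    qmf_coeff_colPoly H j n
  have hhint : ∀ j n, (h j).coeff n ∈ O := fun j n => by
    rw [hcoef_h]
    split_ifs with hn
    · exact hHint _ _
    · exact zero_mem O
  have hhsupp : ∀ j, (h j).support ⊆ U := fun j n hn => by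
    rw [mem_support_iff, hcoef_h] at hn
    by_contra hnU
    exact hn (dif_neg hnU)
  have hδ : ∀ j j', (h j).coeff ((a j' : U) : ℕ) = if j = j' then 1 else 0 := fun j j' => by
    rw [hcoef_h, dif_pos (a j').2]
    exact hHδ j j'
  -- (2) every `g i` is a combination of the `h j` with coefficients `g_{i, a_j}`
  have hg_expand : ∀ i, g i = ∑ j, C ((g i).coeff (a j)) * h j := fun i => by
    ext n
    rw [finsetSum_coeff]
    simp only [coeff_C_mul, hcoef_h]
    by_cases hn : n ∈ U
    · simp only [dif_pos hn]
      have e := congrArg (fun M : Matrix U (Fin s) F => M ⟨n, hn⟩ i) hVH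
      simp only [Matrix.mul_apply, Matrix.submatrix_apply, _root_.id] at e
      change (g i).coeff n = ∑ j, H ⟨n, hn⟩ j * (g i).coeff (a j) at e
      rw [e]
      exact Finset.sum_congr rfl fun j _ => mul_comm _ _
    · simp only [dif_neg hn, mul_zero, Finset.sum_const_zero]
      exact notMem_support_iff.mp fun hmem => hn (hsuppU i hmem)
  -- (3) the representation as a quadratic form in the `h j` with Gram entries as coefficients
  have hqf : (∑ i, C (c i) * g i ^ 2)
      = ∑ j, ∑ j', C (∑ i, c i * (g i).coeff (a j) * (g i).coeff (a j')) * (h j * h j') := by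
    have step1 : ∀ i, C (c i) * g i ^ 2
        = ∑ j, ∑ j', C (c i * (g i).coeff (a j) * (g i).coeff (a j')) * (h j * h j') := fun i => by
      conv_lhs => rw [hg_expand i]
      rw [sq, Finset.sum_mul_sum, Finset.mul_sum]
      refine Finset.sum_congr rfl fun j _ => ?_
      rw [Finset.mul_sum]
      refine Finset.sum_congr rfl fun j' _ => ?_
      simp only [C_mul]
      ring
    rw [Finset.sum_congr rfl fun i _ => step1 i, Finset.sum_comm]
    refine Finset.sum_congr rfl fun j _ => ?_
    rw [Finset.sum_comm]
    refine Finset.sum_congr rfl fun j' _ => ?_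
    rw [← Finset.sum_mul, ← map_sum]
  exact ⟨r, fun j => ((a j : U) : ℕ), h, hr, hhint, hhsupp, hδ, hg_expand, hqf⟩

end Summit.ValiantsHypothesis.ValiantsHypothesis.Theorems.SublinearShadowSketch
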